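/-
Copyright (c) 2026 the pub-hodgecm-mathlib formalisation cell (harness21).  Prover seat hodgecm-mathlib-K2E3-p03 (g4), Track B «K2-LIT» ∕ h413
(`stmt-HodgeConjecture-24833`), line `K2_E3_EllipticInputs`, unit U12, §L leaf (LBGL-3E) (the (F-E) road of K2E3-p11 (g5), H″ plan, brick (γ) W-BOUND):
THE WEIGHT BOUND `√‖disc χ_X‖ ≤ B · ‖χ_X′(a)‖` FOR THE RATIONAL ROOTS `a` OF THE CHARACTERISTIC POLYNOMIAL, UNIFORMLY ON COMPACT SETS OF `3 × 3` MATRICES.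
2026-09-04.
-/
import Summits.HodgeConjecture.HodgeConjecture.Theorems.K2E3CharpolyRootsPerturbation   -- ★ R′ part 1 (this seat): `valuation_le_of_isRoot` (root bound), `continuous_eval_charpoly`; brings ★ `continuous_charpoly_coeff`
import Literature.NumberTheory.Automorphic.LocalFieldHaarBalls                        -- ★ `LocalFieldHaar.continuous_normAbs`
import Literature.NumberTheory.Automorphic.AddCharConductorExponent                   -- ★ `normAbs_le_normAbs_iff` (`‖x‖ ≤ ‖y‖ ↔ v x ≤ v y`)
import Mathlib.RingTheory.Polynomial.Resultant.Basic                                  -- `Polynomial.discr_of_degree_eq_three`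
import HarnessLib

/-!
# K2_E3 road (h413), leaf (LBGL-3E), brick (γ) W-BOUND — `√‖disc χ_X‖_F ≤ B · ‖χ_X′(a)‖_F` uniformly on compact sets

Cell `pub/hodgecm-mathlib` (D-0151), Track B (21-frontier RULING «PUSH BOTH» 2026-09-03, director req624), seat K2E3-p03 (g4); by-name deal of the (F-E)
road owner K2E3-p11 (g5) (squad bus 2026-09-04T06:19:56Z (γ), 06:26:24Z; dealer K2E3-plan (g3) countersign 06:26:43Z).  `--supports stmt-HodgeConjecture-24833
--as helper`; THEOREMS ONLY (no definition ∕ instance ∕ notation ∕ named fact ∕ `sorry`); never imports `Cruxes/…/Lines`.  COUNT-NEUTRAL: this is the bound the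
leaf H″7 uses to dominate the weight `W(X) = C · Σ_{a ∈ roots χ_X} ‖χ_X′(a)‖⁻¹` against `‖disc χ_X‖^{-1/2}`; it closes no socket by itself.

THE RESULTS.  §1 (any commutative ring `R`):
* **`discr_eq_derivative_sq_mul_of_isRoot`** — for `f = T³ + p T² + q T + r` monic with a root `a`:  `disc f = f′(a)² · (p² − 2pa − 3a² − 4q)`
  (the second factor is the discriminant of `f ∕ (T − a)`; Mathlib's explicit cubic discriminant `discr_of_degree_eq_three` and the relation
  `r = −(a³ + p a² + q a)` — a `linear_combination`); with `eval_cubic_of_monic`, `derivative_eval_cubic_of_monic`.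
§2 (`F` a non-archimedean local field, `‖·‖ = normAbs F` the normalised absolute value):
* **`exists_one_le_forall_valuation_le_of_isCompact`** — a compact `S ⊆ F` is valuation-bounded (`‖·‖` is continuous and increasing in `v`);
* **`exists_one_le_forall_valuation_coeff_charpoly_le`** — on a compact `C ⊆ M₃(F)` the coefficients of `χ_X` are uniformly valuation-bounded;
* **`isCompact_setOf_mem_and_isRoot_charpoly`** — `{(X, a) | X ∈ C, χ_X(a) = 0}` is compact (★ R′ root bound `valuation_le_of_isRoot` puts `a` in a compact
  ball, Mathlib `IsNonarchimedeanLocalField.isCompact_closedBall`; closed by ★ `continuous_eval_charpoly`);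
* **`exists_bound_sqrt_discr_le_mul_derivative`** (THE TARGET, (F-E) road owner's signature verbatim) — for `C` compact there is `B : ℝ≥0` with
  `√‖disc χ_X‖ ≤ B · ‖χ_X′(a)‖` for all `X ∈ C` and all roots `a ∈ F` of `χ_X`:  `√‖disc‖ = ‖χ′(a)‖ · √‖p² − 2pa − 3a² − 4q‖` by §1, and the continuous
  second factor is bounded on the compact set of §2.
[HarishChandra1970, Part I §5 (the weight `|D(γ)|^{-1/2}` and the normalisation of orbital integrals); HarishChandra1999AdmissibleDistributions, §7; Cassels1986, Ch. 4 §3]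
HONEST LABEL: HC_CM is proved only modulo the 7 printed citations (2 remaining named inputs: hLiu418 = stmt-HodgeConjecture-24832, h413 =
stmt-HodgeConjecture-24833) until rung 0 closes; count-neutral helper.

## References
* [HarishChandra1970] Harish-Chandra (notes by G. van Dijk), *Harmonic Analysis on Reductive p-adic Groups*, LNM 162 (1970), Part I §5.
* [HarishChandra1999AdmissibleDistributions] Harish-Chandra (notes by S. DeBacker, P. J. Sally), *Admissible Invariant Distributions on Reductive p-adic Groups*,
  AMS ULS 16 (1999), §7.
* [Cassels1986] J. W. S. Cassels, *Local Fields*, LMS Student Texts 3 (1986), Ch. 4 §3.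
-/

set_option autoImplicit false
set_option linter.dupNamespace false   -- `Summit.HodgeConjecture.HodgeConjecture.…` (D-0017 nested layout; lakefile exemption for Summits)

noncomputable section

open Topology Set Polynomial
open scoped Matrix NNReal
open ValuativeRel
open Literature.NumberTheory.Automorphic
open Literature.NumberTheory.GaloisRepresentations.IsNonarchimedeanLocalField
open Summit.HodgeConjecture.HodgeConjecture.Cruxes.H413.K2E3CharpolyRootsPerturbation

namespace Summit.HodgeConjecture.HodgeConjecture.Cruxes.H413.K2E3CubicDiscDerivativeBound

/-! ## §1  The cubic identity `disc f = f′(a)² · (p² − 2pa − 3a² − 4q)` at a root `a` -/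

section Algebra

variable {R : Type*} [CommRing R]

/-- `f(a) = a³ + p a² + q a + r` for `f` monic of degree `3`. [folklore] -/
theorem eval_cubic_of_monic {f : R[X]} (hf : f.Monic) (hdeg : f.natDegree = 3) (a : R) :
    f.eval a = a ^ 3 + f.coeff 2 * a ^ 2 + f.coeff 1 * a + f.coeff 0 := by
  have h3 : f.coeff 3 = 1 := by rw [← hdeg]; exact hf.coeff_natDegree
  rw [eval_eq_sum_range, hdeg]
  simp only [Finset.sum_range_succ, Finset.sum_range_zero, zero_add, pow_zero, mul_one, pow_one, h3, one_mul]
  ring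

/-- `f′(a) = 3a² + 2 p a + q` for `f` monic of degree `3`. [folklore] -/
theorem derivative_eval_cubic_of_monic {f : R[X]} (hf : f.Monic) (hdeg : f.natDegree = 3) (a : R) :
    f.derivative.eval a = 3 * a ^ 2 + 2 * f.coeff 2 * a + f.coeff 1 := by
  have h3 : f.coeff 3 = 1 := by rw [← hdeg]; exact hf.coeff_natDegree
  rw [eval_eq_sum_range' (n := 3) (lt_of_le_of_lt (natDegree_derivative_le f) (by omega))]
  simp only [Finset.sum_range_succ, Finset.sum_range_zero, zero_add, coeff_derivative, h3, pow_zero, pow_one, Nat.cast_zero, Nat.cast_one,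
    Nat.cast_ofNat, one_mul, mul_one]
  ring

/-- **`disc f = f′(a)² · (p² − 2pa − 3a² − 4q)`** for `f = T³ + p T² + q T + r` monic with `f(a) = 0`: the second factor is the discriminant of the quadratic
`f ∕ (T − a)`.  (Mathlib's explicit cubic discriminant + `r = −(a³ + p a² + q a)`.) [cite: Cassels1986, Ch. 4 §3] -/
theorem discr_eq_derivative_sq_mul_of_isRoot {f : R[X]} (hf : f.Monic) (hdeg : f.natDegree = 3) {a : R} (ha : f.IsRoot a) :
    f.discr = (f.derivative.eval a) ^ 2 * (f.coeff 2 ^ 2 - 2 * f.coeff 2 * a - 3 * a ^ 2 - 4 * f.coeff 1) := by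
  have h3 : f.coeff 3 = 1 := by rw [← hdeg]; exact hf.coeff_natDegree
  have hroot : a ^ 3 + f.coeff 2 * a ^ 2 + f.coeff 1 * a + f.coeff 0 = 0 := by rw [← eval_cubic_of_monic hf hdeg a]; exact ha
  have hf0 : f ≠ 0 := ne_zero_of_natDegree_gt (n := 0) (by rw [hdeg]; norm_num)
  have hdeg' : f.degree = 3 := by rw [degree_eq_natDegree hf0, hdeg]; norm_cast
  rw [discr_of_degree_eq_three hdeg', h3, derivative_eval_cubic_of_monic hf hdeg a]
  linear_combination (-27 * f.coeff 0 + 18 * f.coeff 2 * f.coeff 1 - 4 * f.coeff 2 ^ 3 + 27 * (a ^ 3 + f.coeff 2 * a ^ 2 + f.coeff 1 * a)) * hroot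

end Algebra

/-! ## §2  The uniform bound on compact sets of `3 × 3` matrices over a non-archimedean local field -/

section LocalField

variable {F : Type*} [Field F] [ValuativeRel F] [TopologicalSpace F] [IsNonarchimedeanLocalField F]

/-- **A compact subset of `F` is valuation-bounded** (by an `M ≥ 1`): `‖·‖_F` is continuous, attains its maximum on `S`, and is increasing in `v`.
[folklore] -/
theorem exists_one_le_forall_valuation_le_of_isCompact {S : Set F} (hS : IsCompact S) :
    ∃ M : ValueGroupWithZero F, 1 ≤ M ∧ ∀ x ∈ S, valuation F x ≤ M := by
  rcases S.eq_empty_or_nonempty with rfl | hne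
  · exact ⟨1, le_rfl, fun x hx => absurd hx (Set.notMem_empty x)⟩
  obtain ⟨x₀, -, hmax⟩ := hS.exists_isMaxOn hne (LocalFieldHaar.continuous_normAbs (F := F)).continuousOn
  refine ⟨max 1 (valuation F x₀), le_max_left _ _, fun x hx => (normAbs_le_normAbs_iff.1 (hmax hx)).trans (le_max_right _ _)⟩

/-- **Uniform coefficient bound**: on a compact `C ⊆ M₃(F)` all coefficients of `χ_X` have valuation `≤ M` for one `M ≥ 1` (★ `continuous_charpoly_coeff`).
[folklore] -/
theorem exists_one_le_forall_valuation_coeff_charpoly_le {C : Set (Matrix (Fin 3) (Fin 3) F)} (hC : IsCompact C) :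
    ∃ M : ValueGroupWithZero F, 1 ≤ M ∧ ∀ X ∈ C, ∀ i, valuation F (X.charpoly.coeff i) ≤ M := by
  -- the compact union of the coefficient images
  have hS : IsCompact (⋃ i : Fin 4, (fun X : Matrix (Fin 3) (Fin 3) F => X.charpoly.coeff (i : ℕ)) '' C) :=
    isCompact_iUnion fun i => hC.image (Literature.LinearAlgebra.Matrix.continuous_charpoly_coeff (i : ℕ))
  obtain ⟨M, hM1, hM⟩ := exists_one_le_forall_valuation_le_of_isCompact hS
  refine ⟨M, hM1, fun X hX i => ?_⟩
  by_cases hi : i < 4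
  · exact hM _ (Set.mem_iUnion.2 ⟨⟨i, hi⟩, X, hX, rfl⟩)
  · have hdeg : X.charpoly.natDegree = 3 := by rw [Matrix.charpoly_natDegree_eq_dim, Fintype.card_fin]
    rw [coeff_eq_zero_of_natDegree_lt (by omega), map_zero]
    exact zero_le

/-- **`{(X, a) | X ∈ C, χ_X(a) = 0}` is compact** for `C` compact: the roots lie in the compact ball `{v ≤ M}` (★ R′ root bound `valuation_le_of_isRoot`,
Mathlib `IsNonarchimedeanLocalField.isCompact_closedBall`) and the root condition is closed (★ `continuous_eval_charpoly`). [cite: HarishChandra1999AdmissibleDistributions, §7] -/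
theorem isCompact_setOf_mem_and_isRoot_charpoly {C : Set (Matrix (Fin 3) (Fin 3) F)} (hC : IsCompact C) :
    IsCompact {p : Matrix (Fin 3) (Fin 3) F × F | p.1 ∈ C ∧ p.1.charpoly.IsRoot p.2} := by
  obtain ⟨M, hM1, hM⟩ := exists_one_le_forall_valuation_coeff_charpoly_le hC
  have hball : IsCompact {a : F | valuation F a ≤ M} := IsNonarchimedeanLocalField.isCompact_closedBall F M
  have heq : {p : Matrix (Fin 3) (Fin 3) F × F | p.1 ∈ C ∧ p.1.charpoly.IsRoot p.2} =
      (C ×ˢ {a : F | valuation F a ≤ M}) ∩ {p : Matrix (Fin 3) (Fin 3) F × F | p.1.charpoly.eval p.2 = 0} := by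
    ext p
    simp only [Set.mem_setOf_eq, Set.mem_inter_iff, Set.mem_prod]
    constructor
    · rintro ⟨hp, hr⟩
      exact ⟨⟨hp, valuation_le_of_isRoot (Matrix.charpoly_monic _) hM1 (fun i _ => hM _ hp i) hr⟩, hr⟩
    · rintro ⟨⟨hp, -⟩, hr⟩
      exact ⟨hp, hr⟩
  haveI : T2Space F := (Literature.NumberTheory.GaloisRepresentations.IsNonarchimedeanLocalField.isLocalField F).toT2Space
  rw [heq]
  exact (hC.prod hball).inter_right (isClosed_eq continuous_eval_charpoly continuous_const)

/-- **THE WEIGHT BOUND** ((F-E) road, H″7): for `C ⊆ M₃(F)` compact there is `B` with  `√‖disc χ_X‖_F ≤ B · ‖χ_X′(a)‖_F`  for every `X ∈ C` and every root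
`a ∈ F` of `χ_X`.  Proof: `√‖disc χ_X‖ = ‖χ_X′(a)‖ · √‖p² − 2pa − 3a² − 4q‖` (§1), and the continuous second factor is bounded on the compact set
`{(X, a) | X ∈ C, χ_X(a) = 0}`. [cite: HarishChandra1970, Part I §5; cite: HarishChandra1999AdmissibleDistributions, §7] -/
theorem exists_bound_sqrt_discr_le_mul_derivative (C : Set (Matrix (Fin 3) (Fin 3) F)) (hC : IsCompact C) :
    ∃ B : ℝ≥0, ∀ X ∈ C, ∀ a ∈ X.charpoly.roots, NNReal.sqrt (normAbs F X.charpoly.discr) ≤ B * normAbs F (X.charpoly.derivative.eval a) := by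
  -- the continuous cofactor `w(X, a) = p² − 2pa − 3a² − 4q`
  set w : Matrix (Fin 3) (Fin 3) F × F → F := fun p => p.1.charpoly.coeff 2 ^ 2 - 2 * p.1.charpoly.coeff 2 * p.2 - 3 * p.2 ^ 2 - 4 * p.1.charpoly.coeff 1
    with hw
  have hwc : Continuous w := by
    have h2 : Continuous fun p : Matrix (Fin 3) (Fin 3) F × F => p.1.charpoly.coeff 2 :=
      (Literature.LinearAlgebra.Matrix.continuous_charpoly_coeff 2).comp continuous_fst
    have h1 : Continuous fun p : Matrix (Fin 3) (Fin 3) F × F => p.1.charpoly.coeff 1 :=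
      (Literature.LinearAlgebra.Matrix.continuous_charpoly_coeff 1).comp continuous_fst
    exact (((h2.pow 2).sub ((continuous_const.mul h2).mul continuous_snd)).sub (continuous_const.mul (continuous_snd.pow 2))).sub
      (continuous_const.mul h1)
  have hfc : Continuous fun p : Matrix (Fin 3) (Fin 3) F × F => NNReal.sqrt (normAbs F (w p)) :=
    NNReal.continuous_sqrt.comp ((LocalFieldHaar.continuous_normAbs (F := F)).comp hwc)
  -- its bound on the compact root set
  have hK := isCompact_setOf_mem_and_isRoot_charpoly hC
  obtain ⟨B, hB⟩ := (hK.image hfc).bddAbove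
  refine ⟨B, fun X hX a ha => ?_⟩
  have hmon : X.charpoly.Monic := Matrix.charpoly_monic X
  have hdeg : X.charpoly.natDegree = 3 := by rw [Matrix.charpoly_natDegree_eq_dim, Fintype.card_fin]
  have har : X.charpoly.IsRoot a := (mem_roots hmon.ne_zero).1 ha
  have hle : NNReal.sqrt (normAbs F (w (X, a))) ≤ B := hB ⟨(X, a), ⟨hX, har⟩, rfl⟩
  rw [discr_eq_derivative_sq_mul_of_isRoot hmon hdeg har, map_mul, map_pow, NNReal.sqrt_mul, NNReal.sqrt_sq, mul_comm B]
  exact mul_le_mul' le_rfl hle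

end LocalField

end Summit.HodgeConjecture.HodgeConjecture.Cruxes.H413.K2E3CubicDiscDerivativeBound
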